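/-
COR-CM (cell pub-hodgecm2, stage 2 of the Hodge ladder) — count-neutral KERNEL COMBINATORICS «dicyclic twist, even order: blocks, one rule face per
block, the count» (seat prover-pub-hodgecm2-b23-g43-0, binder prover b23, gen 43; claim DICYCLIC-EVEN, HOME/INBOX.md l.10881; blanket
`Census/DicyclicTwist*`).  Bookkeeping definitions with bodies (`ruleFace`, `ruleSpan`, `ruleSpan'`, `familyE`) + theorems, on top of
`Census/DicyclicTwistEvenRule.lean`, `Census/DicyclicTwistEvenGenerate.lean` and parts X–XI of the odd lane (`Census/DicyclicTwistBlocks|Count.lean`,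
gen 42: `Block`, `blk`, `rep`, `potB`, `nu`, `cover_translH/X` used BY NAME); no `decide` beyond closed identities in `ZMod 2`, no certificate, no named
fact, no `sorry`.  `Interfaces.lean` (C1), every E term, B01, `Transposition/*`, `PortJoin/*` untouched.
HONEST FRAMING: `HC_CM` is NOT proved, here or anywhere in the tree; nothing here is a period, a count of record or a headline.
T5: n/a-class (hypothesis binders: `|A|` even, `|A| ≥ 3`); checker: self, 2026-08-23.
-/
import Summits.HodgeConjecture.CorCM.Census.DicyclicTwistEvenRule
import Summits.HodgeConjecture.CorCM.Census.DicyclicTwistEvenGenerate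

/-!
# The dicyclic twist `Dic(ℤ/2 × A)`, `|A|` even, IX: one rule face per block — **`μ ≤ β − 1` in the model for `|A|` even**

§1 The residual parity `ν` of gen 42 is a block invariant on the labels of potential `1` for EVERY `|A| ≥ 3` (its proof in part X used `|A|`
odd only to treat all labels), so the three residual representatives `(0,0), (0,δ t), (0,1+δ t)` lie in three distinct blocks and at most `β − 3`
blocks are non-residual (`card_nonresidual_add_three_le'`).  §2 THE RULE FAMILY: `ruleFace Ψ` = the rule face of part IV through `Ψ` (a choice),
`ruleSpan` = the span of the `G`-translates of `ruleFace (rep B)` over the non-residual blocks, `ruleSpan'` = the same over the blocks off the double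
equator; `ruleSpan` covers every non-residual label, `ruleSpan'` every one off the double equator and is killed by the four functionals — so part
VIII gives **`H₂ ≤ P₂ ⊔ ruleSpan ⊔ closingSpan`** (`hodge₂_le_ruleSpan`).  §3 THE COUNT: the family `familyE` = one rule face per non-residual block
and the two closing squares has `#familyE + 1 ≤ β = #Block A`, consists of rank-four face classes of the three shapes, and its `G`-translates together
with the pairs span `H₂`: **`exists_generating_family_even`** — the even twin of gen 42's `exists_generating_family`, same statement.  All [folklore].

## References
* [Pohlmann1968] H. Pohlmann, Algebraic cycles on abelian varieties of complex multiplication type, Ann. of Math. 88 (1968), Thm 1.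
* [Milne1999] J. S. Milne, Lefschetz motives and the Tate conjecture, Compositio Math. 117 (1999), Prop. 2.1, p. 54.
-/

namespace Summit.HodgeConjecture.CorCM.Census.DicyclicTwist

open Finset
open Summit.HodgeConjecture.CorCM.Census.OddSliceFacesModel
open Summit.HodgeConjecture.CorCM.Census.OddSliceFacesSquares
open Summit.HodgeConjecture.CorCM.Census.OddSliceFacesDescent
open Summit.HodgeConjecture.CorCM.Census.EvenSliceFacesDescent

variable (A : Type) [AddCommGroup A] [Fintype A] [DecidableEq A]

/-! ## §1 Three residual blocks, any parity -/

omit [AddCommGroup A] [DecidableEq A] in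
/-- On a label of class `≤ 1` conjugation flips the weak half indicator (mod 2; `|A| ≥ 3`, any parity). [folklore] -/
theorem lowZ_compl' (h3 : 3 ≤ Fintype.card A) {ψ : Ty A} (hc : clsTy A ψ ≤ 1) :
    (if Fintype.card A - wt A ψ ≤ Fintype.card A / 2 then (1 : ZMod 2) else 0) =
      (if wt A ψ ≤ Fintype.card A / 2 then (1 : ZMod 2) else 0) + 1 := by
  have hw := wt_le A ψ
  have h11 : (1 : ZMod 2) + 1 = 0 := by decide
  unfold clsTy at hc
  by_cases h : wt A ψ ≤ Fintype.card A / 2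
  · rw [if_pos h, if_neg (by omega), h11]
  · rw [if_neg h, if_pos (by omega), zero_add]

omit [DecidableEq A] in
/-- `ν` is invariant under the diagonal motions on labels of potential `≤ 1` (`|A| ≥ 3`, any parity). [folklore] -/
theorem nu_twH' (h3 : 3 ≤ Fintype.card A) (g : ZMod 2 × A) {Ψ : Ty₂ A} (hp : pot A Ψ ≤ 1) : nu A (twH A g Ψ) = nu A Ψ := by
  obtain ⟨a, t⟩ := g
  have h01 : ∀ u : ZMod 2, u = 0 ∨ u = 1 := by decide
  have hc1 : clsTy A Ψ.1 ≤ 1 := by unfold pot at hp; omega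
  have hc2 : clsTy A Ψ.2 ≤ 1 := by unfold pot at hp; omega
  unfold nu twH
  simp only [clsTy_tw]
  rcases h01 a with rfl | rfl
  · simp only [wt_tw_zero]
  · simp only [wt_tw_one, lowZ_compl' A h3 hc1, lowZ_compl' A h3 hc2]
    generalize (if clsTy A Ψ.1 = 0 then (1 : ZMod 2) else 0) = x
    generalize (if wt A Ψ.1 ≤ Fintype.card A / 2 then (1 : ZMod 2) else 0) = y
    generalize (if wt A Ψ.2 ≤ Fintype.card A / 2 then (1 : ZMod 2) else 0) = z
    revert x y z; decide

omit [DecidableEq A] in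
/-- `ν` is invariant under the swap-twist on labels of potential `1` (`|A| ≥ 3`, any parity). [folklore] -/
theorem nu_twX' (h3 : 3 ≤ Fintype.card A) {Ψ : Ty₂ A} (hp : pot A Ψ = 1) : nu A (twX A Ψ) = nu A Ψ := by
  obtain ⟨a, b⟩ := Ψ
  have h11 : (1 : ZMod 2) + 1 = 0 := by decide
  unfold pot at hp
  simp only at hp
  have hca : clsTy A a ≤ 1 := by omega
  have hc : (if clsTy A b = 0 then (1 : ZMod 2) else 0) = (if clsTy A a = 0 then (1 : ZMod 2) else 0) + 1 := by
    by_cases h : clsTy A a = 0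
    · rw [if_pos h, if_neg (by omega), h11]
    · rw [if_neg h, if_pos (by omega), zero_add]
  unfold nu twX
  simp only [clsTy_rev, wt_add_one, wt_rev, lowZ_compl' A h3 hca, hc]
  generalize (if clsTy A a = 0 then (1 : ZMod 2) else 0) = x
  generalize (if wt A a ≤ Fintype.card A / 2 then (1 : ZMod 2) else 0) = y
  generalize (if wt A b ≤ Fintype.card A / 2 then (1 : ZMod 2) else 0) = z
  revert x y z; decide

omit [DecidableEq A] in
/-- **`ν` is a block invariant on the labels of potential `1`** (`|A| ≥ 3`, any parity). [folklore] -/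
theorem nu_eq_of_reach' (h3 : 3 ≤ Fintype.card A) {Ψ Ψ' : Ty₂ A} (hp : pot A Ψ = 1)
    (h : (∃ g : ZMod 2 × A, twH A g Ψ = Ψ' ∨ twH A g (twX A Ψ) = Ψ')) : nu A Ψ = nu A Ψ' := by
  obtain ⟨g, h | h⟩ := h
  · rw [← h, nu_twH' A h3 g (le_of_eq hp)]
  · have hp' : pot A (twX A Ψ) ≤ 1 := by rw [pot_twX]; exact le_of_eq hp
    rw [← h, nu_twH' A h3 g hp', nu_twX' A h3 hp]

/-- **The three residual representatives lie in three distinct blocks** (`|A| ≥ 3`, any parity). [folklore] -/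
theorem three_residual_blocks' (h3 : 3 ≤ Fintype.card A) (t : A) :
    blk A ((0 : Ty A), (0 : Ty A)) ≠ blk A ((0 : Ty A), δ A t) ∧ blk A ((0 : Ty A), (0 : Ty A)) ≠ blk A ((0 : Ty A), 1 + δ A t) ∧
      blk A ((0 : Ty A), δ A t) ≠ blk A ((0 : Ty A), 1 + δ A t) := by
  obtain ⟨p0, p1, p2⟩ := pot_residual A h3 t
  obtain ⟨n1, n2⟩ := nu_residual A h3 t
  refine ⟨fun h => ?_, fun h => ?_, fun h => ?_⟩
  · have := pot_eq_of_reach A ((blk_eq_blk_iff A _ _).mp h); omega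
  · have := pot_eq_of_reach A ((blk_eq_blk_iff A _ _).mp h); omega
  · have := nu_eq_of_reach' A h3 p1 ((blk_eq_blk_iff A _ _).mp h)
    rw [n1, n2] at this
    exact one_ne_zero this

/-- **At most `β − 3` blocks are non-residual** (`|A| ≥ 3`, any parity). [folklore] -/
theorem card_nonresidual_add_three_le' (h3 : 3 ≤ Fintype.card A) :
    (univ.filter fun B : Block A => 2 ≤ potB A B).card + 3 ≤ Fintype.card (Block A) := by
  haveI : Nonempty A := Fintype.card_pos_iff.mp (by omega)
  obtain ⟨t⟩ := (inferInstance : Nonempty A)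
  obtain ⟨d1, d2, d3⟩ := three_residual_blocks' A h3 t
  obtain ⟨p0, p1, p2⟩ := pot_residual A h3 t
  classical
  set R : Finset (Block A) := {blk A ((0 : Ty A), (0 : Ty A)), blk A ((0 : Ty A), δ A t), blk A ((0 : Ty A), 1 + δ A t)} with hR
  have hRc : R.card = 3 := by
    rw [hR, Finset.card_insert_of_notMem (by simp [d1, d2]), Finset.card_pair d3]
  have hdisj : Disjoint (univ.filter fun B : Block A => 2 ≤ potB A B) R := by
    rw [Finset.disjoint_left]
    intro B hB hBR
    rw [Finset.mem_filter] at hB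
    rw [hR, Finset.mem_insert, Finset.mem_insert, Finset.mem_singleton] at hBR
    rcases hBR with rfl | rfl | rfl
    · rw [potB_blk] at hB; omega
    · rw [potB_blk] at hB; omega
    · rw [potB_blk] at hB; omega
  have := Finset.card_le_univ ((univ.filter fun B : Block A => 2 ≤ potB A B) ∪ R)
  rw [Finset.card_union_of_disjoint hdisj, hRc] at this
  exact this

/-! ## §2 One rule face per block -/

/-- **The rule face through `Ψ`** (a choice from `exists_rule`; junk `0` on residual labels or if `|A| < 3`). [folklore] -/
noncomputable def ruleFace (Ψ : Ty₂ A) : Ty₂ A → ℤ :=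
  if h : 3 ≤ Fintype.card A ∧ 2 ≤ pot A Ψ then (exists_rule A h.1 h.2).choose else 0

/-- The properties of the rule face. [folklore] -/
theorem ruleFace_spec (h3 : 3 ≤ Fintype.card A) {Ψ : Ty₂ A} (hΨ : 2 ≤ pot A Ψ) :
    ((∃ (φ : Ty A) (i j : A) (ψ : Ty A), i ≠ j ∧ ruleFace A Ψ = faceVec₀ A φ i j ψ) ∨
        (∃ (ψ φ : Ty A) (i j : A), i ≠ j ∧ ruleFace A Ψ = faceVec₁ A ψ φ i j) ∨
        (∃ (φ : Ty A) (i : A) (ψ : Ty A) (j : A), ruleFace A Ψ = faceVecM A φ i ψ j)) ∧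
      ruleFace A Ψ ∈ hodge₂ A ∧ (ruleFace A Ψ Ψ = 1 ∧ ∀ χ, χ ≠ Ψ → ruleFace A Ψ χ ≠ 0 → pot A χ < pot A Ψ) ∧
      ((∀ s, UE A s (ruleFace A Ψ) = 0) ∧ (∀ s, UX A s (ruleFace A Ψ) = 0)) ∧
      (pot A Ψ < Fintype.card A → SE₀ A (ruleFace A Ψ) = 0 ∧ SE₁ A (ruleFace A Ψ) = 0) := by
  unfold ruleFace
  rw [dif_pos ⟨h3, hΨ⟩]
  exact (exists_rule A h3 hΨ).choose_spec

/-- **The rule span**: the span of the `G`-translates of the rule faces `ruleFace (rep B)` over the non-residual blocks `B`. [folklore] -/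
def ruleSpan : Submodule ℤ (Ty₂ A → ℤ) :=
  Submodule.span ℤ {v | ∃ B : Block A, 2 ≤ potB A B ∧ ∃ g : ZMod 2 × A,
    v = translH A g (ruleFace A (rep A B)) ∨ v = translH A g (translX A (ruleFace A (rep A B)))}

/-- **The lower rule span**: the same over the non-residual blocks OFF the double equator. [folklore] -/
def ruleSpan' : Submodule ℤ (Ty₂ A → ℤ) :=
  Submodule.span ℤ {v | ∃ B : Block A, (2 ≤ potB A B ∧ potB A B < Fintype.card A) ∧ ∃ g : ZMod 2 × A,
    v = translH A g (ruleFace A (rep A B)) ∨ v = translH A g (translX A (ruleFace A (rep A B)))}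

/-- `ruleSpan' ≤ ruleSpan`. [folklore] -/
theorem ruleSpan'_le : ruleSpan' A ≤ ruleSpan A := by
  refine Submodule.span_mono ?_
  rintro v ⟨B, hB, g, hv⟩
  exact ⟨B, hB.1, g, hv⟩

/-- The rule span lies in `H₂` (`|A| ≥ 3`). [folklore] -/
theorem ruleSpan_le_hodge₂ (h3 : 3 ≤ Fintype.card A) : ruleSpan A ≤ hodge₂ A := by
  refine Submodule.span_le.mpr ?_
  rintro v ⟨B, hB, g, rfl | rfl⟩
  · exact translH_mem A (ruleFace_spec A h3 (by rw [pot_rep]; exact hB)).2.1 g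
  · exact translH_mem A (translX_mem A (ruleFace_spec A h3 (by rw [pot_rep]; exact hB)).2.1) g

/-- **The rule span covers every non-residual label** (`|A| ≥ 3`). [folklore] -/
theorem ruleSpan_cover (h3 : 3 ≤ Fintype.card A) (Ψ : Ty₂ A) (hΨ : 2 ≤ pot A Ψ) :
    ∃ v ∈ ruleSpan A, v Ψ = 1 ∧ ∀ χ, χ ≠ Ψ → v χ ≠ 0 → pot A χ < pot A Ψ := by
  have hB : 2 ≤ potB A (blk A Ψ) := by rw [potB_blk]; exact hΨ
  have hr : 2 ≤ pot A (rep A (blk A Ψ)) := by rw [pot_rep]; exact hB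
  have hreach := (blk_eq_blk_iff A (rep A (blk A Ψ)) Ψ).mp (blk_rep A (blk A Ψ))
  have hcov := (ruleFace_spec A h3 hr).2.2.1
  obtain ⟨g, hg | hg⟩ := hreach
  · refine ⟨translH A g (ruleFace A (rep A (blk A Ψ))), Submodule.subset_span ⟨blk A Ψ, hB, g, Or.inl rfl⟩, ?_⟩
    have hc := cover_translH A hcov g
    rw [hg] at hc
    exact hc
  · refine ⟨translH A g (translX A (ruleFace A (rep A (blk A Ψ)))), Submodule.subset_span ⟨blk A Ψ, hB, g, Or.inr rfl⟩, ?_⟩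
    have hc := cover_translH A (cover_translX A hcov) g
    rw [hg] at hc
    exact hc

/-- **The lower rule span covers every non-residual label off the double equator** (`|A| ≥ 3`). [folklore] -/
theorem ruleSpan'_cover (h3 : 3 ≤ Fintype.card A) (Ψ : Ty₂ A) (hΨ : 2 ≤ pot A Ψ) (hlt : pot A Ψ < Fintype.card A) :
    ∃ v ∈ ruleSpan' A, v Ψ = 1 ∧ ∀ χ, χ ≠ Ψ → v χ ≠ 0 → pot A χ < pot A Ψ := by
  have hB : 2 ≤ potB A (blk A Ψ) ∧ potB A (blk A Ψ) < Fintype.card A := by rw [potB_blk]; exact ⟨hΨ, hlt⟩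
  have hr : 2 ≤ pot A (rep A (blk A Ψ)) := by rw [pot_rep]; exact hB.1
  have hreach := (blk_eq_blk_iff A (rep A (blk A Ψ)) Ψ).mp (blk_rep A (blk A Ψ))
  have hcov := (ruleFace_spec A h3 hr).2.2.1
  obtain ⟨g, hg | hg⟩ := hreach
  · refine ⟨translH A g (ruleFace A (rep A (blk A Ψ))), Submodule.subset_span ⟨blk A Ψ, hB, g, Or.inl rfl⟩, ?_⟩
    have hc := cover_translH A hcov g
    rw [hg] at hc
    exact hc
  · refine ⟨translH A g (translX A (ruleFace A (rep A (blk A Ψ)))), Submodule.subset_span ⟨blk A Ψ, hB, g, Or.inr rfl⟩, ?_⟩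
    have hc := cover_translH A (cover_translX A hcov) g
    rw [hg] at hc
    exact hc

/-- **The four functionals kill the lower rule span** (`|A| ≥ 3`). [folklore] -/
theorem killed_of_mem_ruleSpan' (h3 : 3 ≤ Fintype.card A) {v : Ty₂ A → ℤ} (hv : v ∈ ruleSpan' A) :
    (∀ s, UE A s v = 0) ∧ (∀ s, UX A s v = 0) ∧ SE₀ A v = 0 ∧ SE₁ A v = 0 := by
  refine killedE_of_mem_span A ?_ hv
  rintro w ⟨B, hB, g, hw⟩
  have hr : 2 ≤ pot A (rep A B) := by rw [pot_rep]; exact hB.1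
  have hspec := ruleFace_spec A h3 hr
  have hk : (∀ s, UE A s (ruleFace A (rep A B)) = 0) ∧ (∀ s, UX A s (ruleFace A (rep A B)) = 0) ∧ SE₀ A (ruleFace A (rep A B)) = 0 ∧
      SE₁ A (ruleFace A (rep A B)) = 0 :=
    ⟨hspec.2.2.2.1.1, hspec.2.2.2.1.2, (hspec.2.2.2.2 (by rw [pot_rep]; exact hB.2)).1, (hspec.2.2.2.2 (by rw [pot_rep]; exact hB.2)).2⟩
  rcases hw with rfl | rfl
  · exact killedE_translH A hk g
  · exact killedE_translH A (killedE_translX A hk) g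

/-- **`H₂ ≤ P₂ ⊔ ruleSpan ⊔ closingSpan`** (`|A|` even `≥ 3`): part VIII with `S = ruleSpan`, `S′ = ruleSpan'`. [folklore] -/
theorem hodge₂_le_ruleSpan (hev : Even (Fintype.card A)) (h3 : 3 ≤ Fintype.card A) :
    hodge₂ A ≤ pairs₂ A ⊔ ruleSpan A ⊔ closingSpan A :=
  hodge₂_le_even A hev h3 (ruleSpan A) (ruleSpan' A) (ruleSpan'_le A) (ruleSpan_le_hodge₂ A h3) (ruleSpan_cover A h3)
    (ruleSpan'_cover A h3) (fun _ hv => killed_of_mem_ruleSpan' A h3 hv)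

/-! ## §3 The count -/

/-- **The even family**: one rule face per non-residual block and the two closing squares. [folklore] -/
noncomputable def familyE : Finset (Ty₂ A → ℤ) :=
  (univ.filter fun B : Block A => 2 ≤ potB A B).image (fun B => ruleFace A (rep A B)) ∪ {f₁ A, f₂ A}

/-- **`#familyE + 1 ≤ #Block A`** (`|A| ≥ 3`). [folklore] -/
theorem card_familyE_add_one_le (h3 : 3 ≤ Fintype.card A) : (familyE A).card + 1 ≤ Fintype.card (Block A) := by
  have h1 := card_nonresidual_add_three_le' A h3
  have h2 : (familyE A).card ≤ ((univ.filter fun B : Block A => 2 ≤ potB A B).image (fun B => ruleFace A (rep A B))).card +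
      ({f₁ A, f₂ A} : Finset _).card := Finset.card_union_le _ _
  have h4 : (({f₁ A, f₂ A} : Finset (Ty₂ A → ℤ))).card ≤ 2 := Finset.card_le_two
  have h5 := Finset.card_image_le (s := univ.filter fun B : Block A => 2 ≤ potB A B) (f := fun B => ruleFace A (rep A B))
  omega

/-- `ruleSpan` and `closingSpan` lie in the span of the translates of the even family. [folklore] -/
theorem ruleSpan_sup_closingSpan_le :
    ruleSpan A ⊔ closingSpan A ≤ Submodule.span ℤ {v | ∃ f ∈ familyE A, ∃ g : ZMod 2 × A, v = translH A g f ∨ v = translH A g (translX A f)} := by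
  have hfam : ∀ {B : Block A}, 2 ≤ potB A B → ruleFace A (rep A B) ∈ familyE A := fun hB => by
    unfold familyE
    exact Finset.mem_union_left _ (Finset.mem_image_of_mem _ (Finset.mem_filter.mpr ⟨Finset.mem_univ _, hB⟩))
  have hf₁ : f₁ A ∈ familyE A := by unfold familyE; exact Finset.mem_union_right _ (by simp)
  have hf₂ : f₂ A ∈ familyE A := by unfold familyE; exact Finset.mem_union_right _ (by simp)
  refine sup_le (Submodule.span_mono ?_) (Submodule.span_le.mpr ?_)
  · rintro v ⟨B, hB, g, hv⟩
    exact ⟨_, hfam hB, g, hv⟩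
  · rintro v ⟨g, rfl | rfl | rfl | rfl⟩
    · exact Submodule.subset_span ⟨f₁ A, hf₁, g, Or.inl rfl⟩
    · exact Submodule.subset_span ⟨f₂ A, hf₂, g, Or.inl rfl⟩
    · exact Submodule.subset_span ⟨f₁ A, hf₁, g, Or.inr (by rw [translX_f₁])⟩
    · exact Submodule.subset_span ⟨f₂ A, hf₂, g, Or.inr (by rw [translX_f₂])⟩

/-- The members of the even family are Hodge vectors of the three face shapes (`|A| ≥ 3`). [folklore] -/
theorem familyE_shape (h3 : 3 ≤ Fintype.card A) {f : Ty₂ A → ℤ} (hf : f ∈ familyE A) :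
    f ∈ hodge₂ A ∧ ((∃ (φ : Ty A) (i j : A) (ψ : Ty A), i ≠ j ∧ (f = faceVec₀ A φ i j ψ ∨ f = faceVec₁ A ψ φ i j)) ∨
      ∃ (φ : Ty A) (i : A) (ψ : Ty A) (j : A), f = faceVecM A φ i ψ j) := by
  obtain ⟨-, -, -, -, huu', -, hu'u''⟩ := closData_spec A h3
  unfold familyE at hf
  rcases Finset.mem_union.mp hf with hf | hf
  · obtain ⟨B, hB, rfl⟩ := Finset.mem_image.mp hf
    have hr : 2 ≤ pot A (rep A B) := by rw [pot_rep]; exact (Finset.mem_filter.mp hB).2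
    obtain ⟨hshape, hmem, -, -, -⟩ := ruleFace_spec A h3 hr
    refine ⟨hmem, ?_⟩
    rcases hshape with ⟨φ, i, j, ψ, hij, h⟩ | ⟨ψ, φ, i, j, hij, h⟩ | ⟨φ, i, ψ, j, h⟩
    · exact Or.inl ⟨φ, i, j, ψ, hij, Or.inl h⟩
    · exact Or.inl ⟨φ, i, j, ψ, hij, Or.inr h⟩
    · exact Or.inr ⟨φ, i, ψ, j, h⟩
  · rcases Finset.mem_insert.mp hf with rfl | hf
    · exact ⟨(f_mem A).1 |> closingSpan_le_hodge₂ A h3, Or.inl ⟨_, _, _, _, huu', Or.inr rfl⟩⟩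
    · rw [Finset.mem_singleton] at hf; rw [hf]
      exact ⟨(f_mem A).2.1 |> closingSpan_le_hodge₂ A h3, Or.inl ⟨_, _, _, _, hu'u'', Or.inr rfl⟩⟩

/-- **MAIN COUNT THEOREM of the dicyclic twist, `|A|` EVEN `≥ 3`**: a finite family of rank-four face classes with **at most `β − 1` members**
whose `G`-translates, together with the pairs, span the Hodge lattice `H₂` — the even twin of gen 42's `exists_generating_family`. [folklore] -/
theorem exists_generating_family_even (hev : Even (Fintype.card A)) (h3 : 3 ≤ Fintype.card A) :
    ∃ fam : Finset (Ty₂ A → ℤ), fam.card + 1 ≤ Fintype.card (Block A) ∧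
      (∀ f ∈ fam, (∃ (φ : Ty A) (i j : A) (ψ : Ty A), i ≠ j ∧ (f = faceVec₀ A φ i j ψ ∨ f = faceVec₁ A ψ φ i j)) ∨
        ∃ (φ : Ty A) (i : A) (ψ : Ty A) (j : A), f = faceVecM A φ i ψ j) ∧
      pairs₂ A ⊔ Submodule.span ℤ {v | ∃ f ∈ fam, ∃ g : ZMod 2 × A, v = translH A g f ∨ v = translH A g (translX A f)} = hodge₂ A := by
  refine ⟨familyE A, card_familyE_add_one_le A h3, fun f hf => (familyE_shape A h3 hf).2, le_antisymm ?_ ?_⟩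
  · refine sup_le (pairs₂_le_hodge₂ A) (Submodule.span_le.mpr ?_)
    rintro v ⟨f, hf, g, rfl | rfl⟩
    · exact translH_mem A (familyE_shape A h3 hf).1 g
    · exact translH_mem A (translX_mem A (familyE_shape A h3 hf).1) g
  · refine le_trans (hodge₂_le_ruleSpan A hev h3) (sup_le (sup_le le_sup_left ?_) ?_)
    · exact le_trans (le_sup_left.trans (ruleSpan_sup_closingSpan_le A)) le_sup_right
    · exact le_trans (le_sup_right.trans (ruleSpan_sup_closingSpan_le A)) le_sup_right

end Summit.HodgeConjecture.CorCM.Census.DicyclicTwist
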